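import Summits.BirchSwinnertonDyer.Rank1Residual.Supersingular.MazurTateRecordsBW
import HarnessLib

/-!
# Mazur–Tate certificate records BEYOND THE WINDOW for class X7 (good supersingular `p`, `a_p = 0`, `E` not
# semistable), analytic rank one, two engines (B = T): the recheck and a sample
# (cell `b2b-bsdres`, supersingular family prover B = unit `b2b-bsdres-additive-p3`, gen 13; X7 joint with prover A)

HONEST FRAMING (run/shared/lean/b2b/bsd-rank1-residual/, verbatim): the goal of the cell is to
DELETE the COMBINATION-SHAPED residual classes for ALL analytic-rank `≤ 1` elliptic curves over `ℚ`
— "full BSD formula for every rank `≤ 1` curve in class C" assembled STRICTLY from published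
theorems — so that the rank-`≤ 1` remainder becomes exactly the CONSTRUCTION-SHAPED classes, which
are TYPED (missing-input `Prop`s), NOT attempted. This is not "finishing BSD". X7 stays
CONSTRUCTION-SHAPED; DATA records only; nothing is booked (lane + referee); labels unchanged.

## What a row records, and what it certifies (twin of `MazurTateRecordsBW.lean`, p238527, the X8 schema)

Schema `MTRowBW` and every numerical conjunct of the recheck are those of `MazurTateRecordsBW.lean` (engine B =
iw-2's exact modular-symbol Mazur–Tate engine, raw rows `HOME/b2b-bsdres-iw-2/runs/gen7/<jobB>/OUT_SS500K.jsonl`;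
ENGINE T = iw-2's twisted-`L`-value engine, raw rows `runs/gen7|gen8/<jobT>/OUT_ENGT.jsonl`, certificate = the tree
theorem `Iwasawa.mazurTate_mu_eq_zero_and_lam_eq_of_norm_pow_eq`, p230919/p232936: `V < φ(pⁿ)` ⟹
`μ(θ_n) = 0 ∧ λ(θ_n) = V`; fold `tables/engT_layers.tsv`, sha256 `f56d357590e1bb2f0b91918dd6e7d8d505fe37c7c3e80077efee10d78083208b`; the
generator re-derives every emitted row from the RAW job rows and checks raw = fold, 0 mismatches kept); the ONLY
change is the class-sanity conjunct: `cls = "X7" ∧ a_p = 0 ∧ ¬sst` (`MTRowBW.consistentX7`) in place of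
`cls = "X8" ∧ p = 3 ∧ a_3 = ±3`. `a_p(E) = 0` is rechecked by point counting over `𝔽_p` (`apCount`), `p ∤ N`,
`∏ ℓ^e = N`, `sst ↔` all `e = 1` (so `¬sst` = some `e ≥ 2`: class X7), rank `1` (Cremona), `surj = 1` iff
Cremona's galrep list has no code at `p`.

ONE ROW PER PAIR `(E, p)`: the TIGHT colour (`lamL = λ(θ_n) − q_n = 1`; `odd = true`: odd layers, Pollack `L⁺` =
Kobayashi `ε = −1`; `odd = false`: even layers, `L⁻`, `ε = 1`) at the SMALLEST layer `n ≥ 1` of that parity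
where BOTH engines certify `μ(θ_n) = 0`, `λ(θ_n) = q_n + 1 < pⁿ` (engine T: `V = λ < φ(pⁿ)`); when both colours
are tight the odd one is printed (337 pairs); `laterLayers` / `consistentLayers` as in the X8 schema.

WHAT IT CERTIFIES (modulo the two engines): the DATA hypotheses `Θ ≠ 0`, `μ(Θ) = 0`, `λ(Θ) = deg ω_n^± + 1 < pⁿ`
(for `Θ ∈ Λ` with `ι Θ = θ_n`) of `lam_signed_neg_one/one_eq_of_mazurTate'` (`MazurTateCertificates.lean`), hence
`(μ, λ)(L_p^ε(E)) = (0, 1)` for Kobayashi's `L_p^ε`; with `surj = 1` these are the per-pair certificates of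
`kobayashiMainConjecture_neg_one/one_of_mazurTate_of_analyticRank_eq_one` (`SqueezeCertificates.lean`, p214698:
the REAL `KobayashiMainConjecture W p ε` AT THE PAIR from named published facts) and of
`X7.bsdp_of_mazurTate_odd/even_of_corA5_of_analyticRank_eq_one` (`SignedRankOneCorA5.lean`: `BSD(E,p)` with EVERY
other input a named published fact — Kobayashi 2003 Thms. 1.2/4.1, the period-unit facts, Wuthrich 2014 Lemma 20,
GZK, modularity, and the Burungale–Kobayashi–Ota Cor. A.5 reading-fact p239835). NOT a class theorem; nothing
booked; the referee's two-engine rule and the lane decide bookings. Population: the 1303 X7 rows of iw-2's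
`tables/ss500k_tight_r1.tsv` minus the 6 window pairs (`N < 2·10⁴`, already in `MazurTateRecordsX7Three/Large`) —
1252 beyond-window pairs carry ≥ 1 two-engine certified row (45 candidate layers dropped for a raw-vs-fold `V`
mismatch, none used), of which **1175 pairs have a two-engine TIGHT row** (p = 3: 271, p = 5: 271, p = 7: 245, p = 11: 343, p = 13: 45; `ρ̄_{E,p}` onto on 1174 of them —
the exception is `surj = 0` and feeds no main-conjecture theorem; none semistable, by definition of X7; layer 3 needed
for 0). Data files: `MazurTateRecordsBWX7RankOne{A,…}.lean`.
Generator (pure file IO): `HOME/b2b-bsdres-additive-p3/g13/records/` (`gen_mt_bw_records_x7.py`,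
`emit_mt_bw_lean_x7.py`, `mt_bw_rows_x7r1{,_emitted}.json`).
-/

set_option autoImplicit false

namespace Summit.BirchSwinnertonDyer.Rank1Residual.Supersingular.MazurTateRecords

open Summit.BirchSwinnertonDyer.Rank1Residual.Supersingular.VisibilityRecords (apCount)

/-- The X7 recheck evaluated by `decide` on every row: the conjuncts of `MTRowBW.consistent` (five a-invariants
with `a_p(E) = ap` by point counting over `𝔽_p`, `p ∣ a_p`, `p ∤ N`, rank `1`, layer parity = colour, `n ≥ 1`,
`q·(p+1) + (p resp. 1) = pⁿ`, engine B `μ(θ_n) = 0`, `λ(θ_n) = q + lamL < pⁿ`, ENGINE T `μ = 0`,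
`λ = V < φ(pⁿ)`, `λ_T = λ_B`, deeper layers consistent, `∏ ℓ^e = N`, `sst ↔` all `e = 1`) with the class-sanity
clause of X7: `cls = "X7"`, `a_p = 0`, NOT semistable. [folklore] -/
def MTRowBW.consistentX7 (r : MTRowBW) : Bool :=
  (r.ainvs.length == 5) && (apCount r.ainvs r.p == r.ap) && (r.ap % (r.p : ℤ) == 0) && (r.N % r.p != 0) &&
  (r.rank == 1) && (r.layer % 2 == (if r.odd then 1 else 0)) && decide (1 ≤ r.layer) &&
  (r.q * (r.p + 1) + (if r.odd then r.p else 1) == r.p ^ r.layer) &&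
  (r.muB == 0) && (r.lamThetaB == r.q + r.lamL) && decide (r.lamThetaB < r.p ^ r.layer) &&
  (r.muT == 0) && (r.lamT == r.vT) && decide (r.vT < r.p ^ r.layer - r.p ^ (r.layer - 1)) &&
  (r.lamT == r.lamThetaB) && (r.consistentLayers == 1) &&
  (r.Nfactors.foldl (fun acc qe => acc * qe.1 ^ qe.2) 1 == r.N) &&
  (r.sst == r.Nfactors.all (fun qe => qe.2 == 1)) &&
  (r.cls == "X7" && r.ap == 0 && r.sst == false)

/-- A list of beyond-window X7 rows all passing the recheck. [folklore] -/
def CheckedMTBWX7 (rs : List MTRowBW) : Prop := rs.all MTRowBW.consistentX7 = true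

/-- `CheckedMTBWX7 rs` is decidable. [folklore] -/
instance CheckedMTBWX7.instDecidable (rs : List MTRowBW) : Decidable (CheckedMTBWX7 rs) :=
  inferInstanceAs (Decidable (rs.all MTRowBW.consistentX7 = true))

/-- Every member of a checked list is consistent. [folklore] -/
theorem CheckedMTBWX7.consistent_of_mem {rs : List MTRowBW} (h : CheckedMTBWX7 rs) {r : MTRowBW} (hr : r ∈ rs) :
    r.consistentX7 = true :=
  List.all_eq_true.mp h r hr

/-- **Sample (the two smallest-conductor beyond-window X7 rank-one tight pairs at `p = 3`), CONSISTENT** — the data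
files `MazurTateRecordsBWX7RankOne*.lean` carry all 1175 rows. [folklore] -/
theorem checkedMTBWX7_rankOne_sample : CheckedMTBWX7 [
  { label := "31216d1", ainvs := [0, 0, 0, (-131), (-638)], N := 31216, Nfactors := [(2, 4), (1951, 1)], p := 3, cls := "X7", ap := 0, rank := 1, surj := 1, sst := false, odd := true, layer := 1, q := 0, muB := 0, lamThetaB := 1, lamL := 1, vT := 1, muT := 0, lamT := 1, laterLayers := 1, consistentLayers := 1, jobB := "j094269", jobT := "j098039" },
  { label := "34594i1", ainvs := [1, (-1), 1, (-328), 2279], N := 34594, Nfactors := [(2, 1), (7, 2), (353, 1)], p := 3, cls := "X7", ap := 0, rank := 1, surj := 1, sst := false, odd := true, layer := 1, q := 0, muB := 0, lamThetaB := 1, lamL := 1, vT := 1, muT := 0, lamT := 1, laterLayers := 1, consistentLayers := 1, jobB := "j094271", jobT := "j098017" } ] := by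
  decide

end Summit.BirchSwinnertonDyer.Rank1Residual.Supersingular.MazurTateRecords
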